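import Summits.AtomisticToContinuum.Crystallization.Theorems.FrustratedLawDichotomyCellF1cUncompressed

/-!
# FrustratedLawDichotomy · crux `AperiodicFrustratedLawGap` (stmt-AtomisticToContinuum-27623) — the cell-arithmetic leaf of (404′) SHARPENED:
# ★ KF1c ROOTS ARE UNCOMPRESSED UP TO `r₁ = 0.956` (the EXACT label minimum of the F1 class key, in place of (428)'s row-slack radius `0.892`)
# (decomp-a2c hand-1 g58 (H7); sequel of (428) `…CellF1cUncompressed`, same format, critic r1914 (A) (H2) category «cell-arithmetic leaf»)

(428) proves that every rooted `7/10`-hard-core member of the F1 row of record `KF1c` carries the compression mark `Uncompressed r₁` at its root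
whenever `(r₁ + 2⁻¹⁰)² ≤ (1 − 3·2⁻¹⁰)·(2/5)·2 = 0.7977` (`r₁ ≤ 0.892`), from the Gershgorin ROW SLACK `2/5` of `TᵀT` and the parity bound `|m|² ≥ 2`.
The F1 template is `T = diag(10477/16384, 5853/8192, 5853/8192)` (`…CellF1Frame.TQ`), the template scalar of a label is the INTEGER class key,
`Σᵢ (T·z(m))ᵢ² = qk m / 16384²` (`…CellF1Frame.sumSq_T`), and over nonzero PARITY labels the key is minimised at `m = (±1, ±1, 0)`:
`qk m ≥ 109767529 + 137030436 = 246797965`, i.e. `Σᵢ (T·z)ᵢ² ≥ 0.91939` (template nearest-neighbour distance `0.9589`).  THIS FILE re-runs (428) §1–§2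
with that exact minimum (pure arithmetic on the closed form `qk_eq` — no `decide`, valid for EVERY parity label, not only `MF1c`):
* §1 `qk_ge_of_even_ne_zero`; ★ `le_norm_posL_aF1` (`gram_ge_nearId` + `norm_sq_posL` + `sumSq_T`: `‖posL F (aF1 m)‖ ≥ L` for `F ∈ BF1`, `m ≠ 0` parity,
  `L² ≤ (1 − 3·2⁻¹⁰)·246797965/16384² = 0.91670`); `norm_atom_ge_of_mem_rowF1c'`, `voidShell_null_of_mem_rowF1c'` / `…KF1c'` and
  ★★ `uncompressed_of_mem_KF1c'` = (428) `uncompressed_of_mem_KF1c` with the hypothesis `(r₁ + 2⁻¹⁰)² ≤ 0.91670…` (any `r₁ ≤ 0.9564`) in place of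
  `≤ 0.7977` (`r₁ ≤ 0.892`); instances ★★ `uncompressed_95_of_mem_KF1c` (the new dial `19/20`) and `uncompressed_956_of_mem_KF1c` (margin).
* §2 ★★ `hfloorT_KF1c'` / `hfloorT_KF1c_95`: the F1 transported row floor `e⋆ + 23/10⁴ ≤ rootEnergy μ + net 0 (compPull r₁ R a) μ`, UNCONDITIONAL, for every
  `r₁ ≤ 0.9564` (#129 `hfloor_KF1c` + (404′) `floorT_of_floor_uncompressed`); the (428) §3 junctions and §4 sanity apply verbatim with `hfloorT_KF1c'` / `uncompressed_95_of_mem_KF1c`.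
WHY (hand-2 g50 FINDING / #132's Nash cap slot): the inhabitants deciding the SHRUNK slot are infinite JAMMED configurations — an ideal 12-shell root in
surroundings compressed by `q` (desk: `q = 3 %` ⇒ deficit `≈ +0.05`, `10 %` ⇒ `≈ +0.2`); the root is uncompressed while its far field has pairs at
`0.971·(1 − q)`, which `compPull r₁` CHARGES once `0.971·(1 − q) < r₁`: `4/5` sees `q ≥ 18 %`, (428)'s `0.892` sees `q ≥ 8 %`, `0.956` sees `q ≥ 1.5 %`.
HONEST LABELS.  Cell arithmetic only: no cap `D_T`, no reach figure, nothing on A(η); the radius is what the CERTIFIED template allows (exact key minimum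
× near-identity strain − tube).  Imports TREE (428) `…CellF1cUncompressed` only; theorems only; 0 sorry; no `decide`.  Tags: [new: cell arithmetic].
-/

noncomputable section

namespace Summit.AtomisticToContinuum.Crystallization.Theorems.FrustratedLawDichotomyCellF1cUncompressed95

open MeasureTheory Metric Set
open scoped ENNReal BigOperators
open Literature.MathematicalPhysics.StatisticalMechanics (lennardJones rootEnergy)
open Literature.Probability.Process (IsRootedHardCore count_restrict_singleton_ne_zero_iff)
open Summit.AtomisticToContinuum.Crystallization.Theorems.ChargedEnergyGapNegative (E3 eStar)
open Summit.AtomisticToContinuum.Crystallization.Theorems.FrustratedLawDichotomySignedLedger (net)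
open Summit.AtomisticToContinuum.Crystallization.Theorems.FrustratedLawDichotomyCoherentSets (coherentAt count_restrict_mem_coherentAt_iff')
open Summit.AtomisticToContinuum.Crystallization.Theorems.FrustratedLawDichotomyCellData (gram_ge_nearId)
open Summit.AtomisticToContinuum.Crystallization.Theorems.FrustratedLawDichotomyCellMetric (posL posL_zero norm_sq_posL)
open Summit.AtomisticToContinuum.Crystallization.Theorems.FrustratedLawDichotomyCellTriples (zT sumT)
open Summit.AtomisticToContinuum.Crystallization.Theorems.FrustratedLawDichotomyCellF1Frame (T qk qk_eq sumSq_T)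
open Summit.AtomisticToContinuum.Crystallization.Theorems.FrustratedLawDichotomyCellF1cLabels (MF1c hparc zero_mem_Mc)
open Summit.AtomisticToContinuum.Crystallization.Theorems.FrustratedLawDichotomyCellF1Symm (BF1 mem_BF1)
open Summit.AtomisticToContinuum.Crystallization.Theorems.FrustratedLawDichotomyCellF1Pos (aF1 aF1_root)
open Summit.AtomisticToContinuum.Crystallization.Theorems.FrustratedLawDichotomyCellF1cRow (KF1c KF1c_subset)
open Summit.AtomisticToContinuum.Crystallization.Theorems.FrustratedLawDichotomyCellF1cCert (hfloor_KF1c)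
open Summit.AtomisticToContinuum.Crystallization.Theorems.FrustratedLawDichotomyAtlasReachTransport (voidShell measurableSet_voidShell
  Uncompressed uncompressed_zero_iff compPull floorT_of_floor_uncompressed)

/-! ## §1 ★ The exact label minimum and the sharpened void window -/

/-- An integer other than `0`, `1`, `−1` has square `≥ 4`. [folklore] -/
theorem four_le_mul_self_of_ne {a : ℤ} (h0 : a ≠ 0) (h1 : a ≠ 1) (h2 : a ≠ -1) : 4 ≤ a * a := by
  rcases le_or_gt a (-2) with h | h
  · nlinarith
  · have h' : 2 ≤ a := by omega
    nlinarith

/-- A nonzero integer has square `≥ 1`. [folklore] -/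
theorem one_le_mul_self_of_ne_zero {a : ℤ} (h : a ≠ 0) : 1 ≤ a * a := by
  rcases lt_or_gt_of_ne h with h' | h'
  · nlinarith
  · nlinarith

/-- ★ THE CLASS KEY MINIMUM OVER NONZERO PARITY LABELS: `qk m ≥ qk (1,1,0) = 246797965` for `m ≠ 0` with even coordinate sum (`|a| ≥ 2` gives
`≥ 4·109767529`; `a = 0` forces `b² + c² ≥ 2` by parity; `a = ±1` forces `b² + c² ≥ 1`). [new: cell arithmetic] -/
theorem qk_ge_of_even_ne_zero {m : ℤ × ℤ × ℤ} (hpar : Even (sumT m)) (hm0 : m ≠ 0) : (246797965 : ℤ) ≤ qk m := by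
  obtain ⟨a, b, c⟩ := m
  rw [qk_eq]
  simp only [sumT] at hpar
  obtain ⟨k, hk⟩ := hpar
  dsimp only at hk ⊢
  have hb0 := mul_self_nonneg b; have hc0 := mul_self_nonneg c
  by_cases ha0 : a = 0
  · subst ha0
    by_cases hb : b = 0
    · subst hb
      have hc : c ≠ 0 := by rintro rfl; exact hm0 rfl
      have hc2 : c ≠ 1 := by omega
      have hc3 : c ≠ -1 := by omega
      nlinarith [four_le_mul_self_of_ne hc hc2 hc3]
    · by_cases hc : c = 0
      · subst hc
        have hb2 : b ≠ 1 := by omega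
        have hb3 : b ≠ -1 := by omega
        nlinarith [four_le_mul_self_of_ne hb hb2 hb3]
      · nlinarith [one_le_mul_self_of_ne_zero hb, one_le_mul_self_of_ne_zero hc]
  · by_cases ha1 : a = 1 ∨ a = -1
    · have haa : a * a = 1 := by rcases ha1 with rfl | rfl <;> norm_num
      have hbc : b ≠ 0 ∨ c ≠ 0 := by
        by_contra h
        push Not at h
        obtain ⟨rfl, rfl⟩ := h
        rcases ha1 with rfl | rfl <;> omega
      rcases hbc with hb | hc
      · nlinarith [one_le_mul_self_of_ne_zero hb]
      · nlinarith [one_le_mul_self_of_ne_zero hc]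
    · push Not at ha1
      nlinarith [four_le_mul_self_of_ne ha0 ha1.1 ha1.2]

/-- ★ THE SHARPENED LINEAR RADIUS: `‖posL F (aF1 m)‖ ≥ L` for `F` in the strain cell, `m ≠ 0` a parity label, `L² ≤ (1 − 3·2⁻¹⁰)·246797965/16384²`
(`gram_ge_nearId` × `sumSq_T` × the key minimum). [new: cell arithmetic] -/
theorem le_norm_posL_aF1 {F : Matrix (Fin 3) (Fin 3) ℝ} (hG : ∀ i j, |(F.transpose * F) i j - (if i = j then 1 else 0)| ≤ 1 / 1024)
    {L : ℝ} (hL : L ^ 2 ≤ (1 - 3 * (1 / 1024)) * (246797965 / 16384 ^ 2)) {m : ℤ × ℤ × ℤ} (hpar : Even (sumT m)) (hm0 : m ≠ 0) :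
    L ≤ ‖posL F (aF1 m)‖ := by
  have hq : (246797965 : ℝ) ≤ (qk m : ℝ) := by exact_mod_cast qk_ge_of_even_ne_zero hpar hm0
  have hsum : ∑ i, (aF1 m i) ^ 2 = (qk m : ℝ) / 16384 ^ 2 := sumSq_T m
  have hgram := gram_ge_nearId hG (aF1 m)
  have hsq : L ^ 2 ≤ ‖posL F (aF1 m)‖ ^ 2 := by
    rw [norm_sq_posL]
    refine hL.trans (le_trans ?_ hgram)
    rw [hsum]
    exact mul_le_mul_of_nonneg_left (by rw [div_le_div_iff_of_pos_right (by positivity)]; exact hq) (by norm_num)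
  exact (abs_le_of_sq_le_sq' hsq (norm_nonneg _)).2

/-- ★ THE GEOMETRIC CORE, SHARPENED ((428) `norm_atom_ge_of_mem_rowF1c` with the exact key minimum): every window atom `p ≠ 0` of a rooted
`7/10`-hard-core configuration coherent with the strained F1 template has `‖p‖ ≥ L − 2⁻¹⁰`, `L² ≤ (1 − 3·2⁻¹⁰)·246797965/16384²`. [new: cell arithmetic] -/
theorem norm_atom_ge_of_mem_rowF1c' {L : ℝ} (hL : L ^ 2 ≤ (1 - 3 * (1 / 1024)) * (246797965 / 16384 ^ 2)) {μ : Measure E3}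
    (hμ : IsRootedHardCore (7 / 10) μ) (hrow : μ ∈ ⋃ F ∈ BF1, coherentAt (MF1c.image fun m => posL F (aF1 m)) (1 / 1024) 13) {p : E3}
    (hp : μ {p} ≠ 0) (hp0 : p ≠ 0) (hp13 : ‖p‖ ≤ 13) : L - 1 / 1024 ≤ ‖p‖ := by
  obtain ⟨S, h0S, hsep, rfl⟩ := hμ
  have hpS : p ∈ S := (count_restrict_singleton_ne_zero_iff S p).1 hp
  have h7 : (7 / 10 : ℝ) ≤ ‖p‖ := by
    have h := hsep p hpS 0 h0S hp0
    rwa [dist_zero_right] at h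
  obtain ⟨F, hF, hcoh⟩ := Set.mem_iUnion₂.mp hrow
  have hG := mem_BF1.mp hF
  have hsub := ((count_restrict_mem_coherentAt_iff' S _ (1 / 1024) 13).mp hcoh).2
  have hpw : p ∈ S ∩ closedBall (0 : E3) 13 := ⟨hpS, mem_closedBall.mpr (by rwa [dist_zero_right])⟩
  obtain ⟨x, hx, hpx⟩ := Set.mem_iUnion₂.mp (hsub hpw)
  obtain ⟨m, hm, rfl⟩ := Finset.mem_image.mp hx
  have hpx' : dist p (posL F (aF1 m)) ≤ 1 / 1024 := by rw [mem_closedBall] at hpx; exact hpx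
  by_cases hm0 : m = 0
  · subst hm0
    rw [aF1_root, posL_zero, dist_zero_right] at hpx'
    have hL1 : L ≤ 1 := by nlinarith [hL, sq_nonneg (L - 1)]
    linarith
  · have hfar : L ≤ ‖posL F (aF1 m)‖ := le_norm_posL_aF1 hG hL (hparc m hm) hm0
    have htri := norm_sub_norm_le (posL F (aF1 m)) p
    rw [← dist_eq_norm, dist_comm] at htri
    linarith

/-- ★ THE VOID WINDOW IS NULL, SHARPENED: for `(r₁ + 2⁻¹⁰)² ≤ (1 − 3·2⁻¹⁰)·246797965/16384²` (any `r₁ ≤ 0.9564`) a rooted `7/10`-hard-core member of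
the real-`F` F1 row has no atom in `ball 0 r₁ ∖ {0}`. [new: cell arithmetic] -/
theorem voidShell_null_of_mem_rowF1c' {r₁ : ℝ} (hr : (r₁ + 1 / 1024) ^ 2 ≤ (1 - 3 * (1 / 1024)) * (246797965 / 16384 ^ 2)) {μ : Measure E3}
    (hμ : IsRootedHardCore (7 / 10) μ) (hrow : μ ∈ ⋃ F ∈ BF1, coherentAt (MF1c.image fun m => posL F (aF1 m)) (1 / 1024) 13) :
    μ (voidShell r₁) = 0 := by
  have hr1 : r₁ + 1 / 1024 ≤ 1 := by nlinarith [hr, sq_nonneg (r₁ + 1 / 1024 - 1)]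
  have hμ' := hμ
  obtain ⟨S, -, -, rfl⟩ := hμ'
  rw [Measure.restrict_apply (measurableSet_voidShell r₁), Measure.count_eq_zero_iff, Set.eq_empty_iff_forall_notMem]
  rintro p ⟨⟨hpb, hp0⟩, hpS⟩
  rw [mem_ball_zero_iff] at hpb
  have hp0' : p ≠ 0 := fun h => hp0 (by rw [h]; exact Set.mem_singleton 0)
  have h := norm_atom_ge_of_mem_rowF1c' hr hμ hrow ((count_restrict_singleton_ne_zero_iff S p).2 hpS) hp0' (by linarith)
  linarith

/-- ★ the void window is null on the ROW OF RECORD `KF1c` (#110 `KF1c_subset`). [new: cell arithmetic] -/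
theorem voidShell_null_of_mem_KF1c' {r₁ : ℝ} (hr : (r₁ + 1 / 1024) ^ 2 ≤ (1 - 3 * (1 / 1024)) * (246797965 / 16384 ^ 2)) {μ : Measure E3}
    (hμ : IsRootedHardCore (7 / 10) μ) (hK : μ ∈ KF1c) : μ (voidShell r₁) = 0 :=
  voidShell_null_of_mem_rowF1c' hr hμ (KF1c_subset hK)

/-- ★★ **F1-COHERENT ROOTS ARE UNCOMPRESSED UP TO `0.9564`**: every rooted `7/10`-hard-core member of `KF1c` carries `Uncompressed r₁` at its root,
for every `r₁` with `(r₁ + 2⁻¹⁰)² ≤ (1 − 3·2⁻¹⁰)·246797965/16384²`. [new: cell arithmetic] -/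
theorem uncompressed_of_mem_KF1c' {r₁ : ℝ} (hr : (r₁ + 1 / 1024) ^ 2 ≤ (1 - 3 * (1 / 1024)) * (246797965 / 16384 ^ 2)) {μ : Measure E3}
    (hμ : IsRootedHardCore (7 / 10) μ) (hK : μ ∈ KF1c) : Uncompressed r₁ μ 0 :=
  (uncompressed_zero_iff r₁ μ).2 ⟨hμ, voidShell_null_of_mem_KF1c' hr hμ hK⟩

/-- ★★ THE NEW DIAL `r₁ = 19/20`: KF1c roots are `Uncompressed (19/20)`. [new: cell arithmetic] -/
theorem uncompressed_95_of_mem_KF1c {μ : Measure E3} (hμ : IsRootedHardCore (7 / 10) μ) (hK : μ ∈ KF1c) : Uncompressed (19 / 20) μ 0 :=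
  uncompressed_of_mem_KF1c' (by norm_num) hμ hK

/-- the margin: the same holds up to `r₁ = 956/1000` (the strained F1 nearest-neighbour distance is `≥ 0.9574`). [new: cell arithmetic] -/
theorem uncompressed_956_of_mem_KF1c {μ : Measure E3} (hμ : IsRootedHardCore (7 / 10) μ) (hK : μ ∈ KF1c) : Uncompressed (956 / 1000) μ 0 :=
  uncompressed_of_mem_KF1c' (by norm_num) hμ hK

/-! ## §2 ★★ The F1 transported row floor, unconditional, at every `r₁ ≤ 0.9564` -/

/-- ★★ **THE F1 TRANSPORTED ROW FLOOR, UNCONDITIONAL** at the sharpened radius: every rooted `7/10`-hard-core NASH member of `KF1c` has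
`e⋆ + 23/10⁴ ≤ rootEnergy μ + net 0 (compPull r₁ R a) μ` (#129 `hfloor_KF1c` through (404′) `floorT_of_floor_uncompressed`). [new: cell arithmetic] -/
theorem hfloorT_KF1c' {r₁ : ℝ} (hr : (r₁ + 1 / 1024) ^ 2 ≤ (1 - 3 * (1 / 1024)) * (246797965 / 16384 ^ 2)) (R a : ℝ) :
    ∀ μ : Measure E3, IsRootedHardCore (7 / 10) μ →
      (∀ p : E3, μ {p} ≠ 0 → ∀ w : E3, (∀ q : E3, μ {q} ≠ 0 → q ≠ p → w ≠ q) →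
        ∑' q : {q : E3 // μ {q} ≠ 0 ∧ q ≠ p}, lennardJones (dist p (q : E3)) ≤
          ∑' q : {q : E3 // μ {q} ≠ 0 ∧ q ≠ p}, lennardJones (dist w (q : E3))) →
      μ ∈ KF1c → eStar + 23 / 10000 ≤ rootEnergy lennardJones μ + net 0 (compPull r₁ R a) μ :=
  fun μ hμ hN hK => floorT_of_floor_uncompressed (uncompressed_of_mem_KF1c' hr hμ hK) (hfloor_KF1c μ hμ hN hK)

/-- ★★ the transported F1 floor at the new dial `r₁ = 19/20` (every pull radius `R` and weight `a`). [new: cell arithmetic] -/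
theorem hfloorT_KF1c_95 (R a : ℝ) :
    ∀ μ : Measure E3, IsRootedHardCore (7 / 10) μ →
      (∀ p : E3, μ {p} ≠ 0 → ∀ w : E3, (∀ q : E3, μ {q} ≠ 0 → q ≠ p → w ≠ q) →
        ∑' q : {q : E3 // μ {q} ≠ 0 ∧ q ≠ p}, lennardJones (dist p (q : E3)) ≤
          ∑' q : {q : E3 // μ {q} ≠ 0 ∧ q ≠ p}, lennardJones (dist w (q : E3))) →
      μ ∈ KF1c → eStar + 23 / 10000 ≤ rootEnergy lennardJones μ + net 0 (compPull (19 / 20) R a) μ :=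
  hfloorT_KF1c' (by norm_num) R a

end Summit.AtomisticToContinuum.Crystallization.Theorems.FrustratedLawDichotomyCellF1cUncompressed95

end
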